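/-
Copyright (c) 2026 the pub-hodgecm-mathlib formalisation cell (harness21).  Prover seat hodgecm-mathlib-K2E3-p26 (g0), Track B «K2-LIT» ∕ h413
(`stmt-HodgeConjecture-24833`), line `K2_E3_EllipticInputs`, unit U12 §11-RANK, road (11-2-split-nsc) — PAYER of the leaf
`sig_K2E3CharLocIntNearSemisimpleSplitTwoNonSupercuspidal` (U12 MAIN ED. 32 :1028, deal D109): ROW 11 FOR `U₂(H)(L⁺_v) ≃ GL₂(L_w)` AT A SPLIT PLACE,
NON-SUPERCUSPIDAL CLASS.  2026-09-04.
-/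
import Summits.HodgeConjecture.HodgeConjecture.Theorems.K2E3GL2PrincipalBlockStandardSpan              -- (2-S-A′) part 2 (this seat): `principalBlockStandardSpan_two` (the GL₂ principal-block standard span)
import Summits.HodgeConjecture.HodgeConjecture.Theorems.K2E3GL2BorelKMUAbsCont                        -- ★ (AC-B)₂ p860503 (K2E3-p14 (g7), D112): `borelKMU_absolutelyContinuous_two`
import Summits.HodgeConjecture.HodgeConjecture.Theorems.K2E3CharLocIntNearParabolicIndOfAC              -- ★ (nsc-vD-gen) p858529 (K2E3-p11 (g6)): `charLocIntNear_parabolicIndGL_of_ac` (generic `N`, `c`)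
import Summits.HodgeConjecture.HodgeConjecture.Theorems.K2E3CharLocIntNearLinearCombination            -- ★ (nsc-LC) p858540 (K2E3-p11 (g6)): `charLocIntNear_congr∕_add∕_finset_sum∕_trivial_twist_gl`
import Summits.HodgeConjecture.HodgeConjecture.Theorems.K2E3CharLocIntNearSplitNonSupercuspidalTransport -- ★ (nsc-T) p858454 (K2E3-p03 (g5)): `charLocIntNearSemisimple_of_split_nonSupercuspidal` (generic `N`)
import Literature.NumberTheory.Automorphic.ParabolicInductionSupercuspidalProofs                       -- ★ `isSupercuspidal_iff_jacquetGL_holds` (Harish-Chandra ∕ Jacquet criterion on `GL_n`)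
import HarnessLib

/-!
# K2_E3 road (h413), leaf (11-2-split-nsc) — the payer: row 11 for non-supercuspidal classes of `U₂(H)(L⁺_v)` at a split place

Cell `pub/hodgecm-mathlib` (D-0151), Track B, seat K2E3-p26 (g0), dealer K2E3-plan (g4) deal D109, architect K2E3-p25 (g2).  `--supports stmt-HodgeConjecture-24833
--as helper`; THEOREMS ONLY (no definition ∕ instance ∕ notation ∕ named fact ∕ `sorry`); never imports `Cruxes/…/Lines`.  The LAST theorem carries the bytes of the
socket (11-2-split-nsc) `sig_K2E3CharLocIntNearSemisimpleSplitTwoNonSupercuspidal` token for token; the dealer ties `:= charLocIntNearSemisimple_splitTwo_nonSupercuspidal`.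

THE MATHEMATICS — the `N = 2` twin of the ★∕REL (11-3-split-nsc) chain of U12 §11-CLS ([vanDijk1972, Thm. p. 237]; [BernsteinZelevinsky1977, Thm. 2.5, §2.3];
[HarishChandra1999, Thm. 16.1 p. 77]; [Zelevinsky1980, Ex. 3.2]).  For `F` a non-archimedean local field of characteristic `0` and `π` an admissible irreducible
NON-supercuspidal representation of `GL₂(F)`, Harish-Chandra's criterion (★ `isSupercuspidal_iff_jacquetGL_holds`) gives a proper standard parabolic `P_c`,
`c : Fin 2 → Fin r` surjective with `2 ≤ r ≤ 2`, with `r_c π ≠ 0` — the Borel; the GL₂ principal-block standard span ((2-S-A′) `principalBlockStandardSpan_two`)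
writes `χ_{[π]}` as a ℤ-combination of characters of principal series `Ind_B(χ)` and of one-dimensional `η`; each `χ_{Ind_B(χ)}` is an integrable function near
every `g` (★ (nsc-vD-gen) van Dijk's `K M U` form + ★ (AC-B)₂ absolute continuity of the Borel KMU push-forward of `GL₂` + ★ Radon–Nikodym), each `η` is locally
constant, and the property is stable under finite linear combinations (★ (nsc-LC)): the conclusion of row 11 (GL-11) holds for `[π]` at EVERY `g ∈ GL₂(F)`
(`charLocIntNear_gl2_of_not_isSupercuspidal`).  ★ (nsc-T) transports it along `U₂(H)(L⁺_v) ≃ₜ* GL₂(L_w)` (`w ∣ v` moved by complex conjugation) to every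
non-supercuspidal class of `U₂(H)(L⁺_v)`, every Haar `μ`, every semisimple `s` — the leaf.

* `charLocIntNear_of_principalBlock_two` — (GL-11) at every `g` for a class in the principal block (= U12 helper `charLocIntNear_of_principalBlock` at `N = 2`);
* `charLocIntNear_gl2_of_not_isSupercuspidal` — (GL-11) at every `g` for every admissible irreducible non-supercuspidal `π` of `GL₂(F)`;
* **`charLocIntNearSemisimple_splitTwo_nonSupercuspidal`** — the socket bytes (11-2-split-nsc).

HONEST LABEL: HC_CM is proved only modulo the 7 printed citations (2 remaining named inputs: hLiu418 = stmt-HodgeConjecture-24832, h413 =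
stmt-HodgeConjecture-24833) until rung 0 closes; count-neutral until the dealer's tie (the tie closes ONE hosted leaf of row 11, not the socket U12-c).

## References
* [vanDijk1972] G. van Dijk, *Computation of certain induced characters of 𝔭-adic groups*, Math. Ann. 199 (1972), 229–240, Thm. p. 237.
* [HarishChandra1999] Harish-Chandra (DeBacker–Sally), *Admissible Invariant Distributions on Reductive p-adic Groups* (1999), §16 Thm. 16.1 p. 77.
* [BernsteinZelevinsky1977] I. N. Bernstein, A. V. Zelevinsky, *Induced representations of reductive 𝔭-adic groups I*, Ann. Sci. ÉNS 10 (1977), Thm. 2.5, §2.3.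
* [BernsteinZelevinsky1976] I. N. Bernstein, A. V. Zelevinsky, *Representations of the group GL(n,F)*, Russian Math. Surveys 31 (1976), Thm. 3.21, Thm. 3.25.
* [Zelevinsky1980] A. V. Zelevinsky, *Induced representations of reductive 𝔭-adic groups II*, Ann. Sci. ÉNS 13 (1980), Ex. 3.2, Thm. 4.2.
* [PlatonovRapinchuk1994] V. Platonov, A. Rapinchuk, *Algebraic Groups and Number Theory* (1994), §5.1 (local models of unitary groups at split places).
-/

set_option autoImplicit false
set_option linter.dupNamespace false

noncomputable section

open MeasureTheory MeasureTheory.Measure NumberField IsDedekindDomain Set Filter Topology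
open scoped Matrix MatrixGroups NNReal ENNReal
open Literature.NumberTheory.Rogawski1990 Literature.NumberTheory.Automorphic Literature.NumberTheory.Automorphic.UnitaryGroup
open Literature.NumberTheory.GaloisRepresentations Literature.NumberTheory.GaloisRepresentations.IsNonarchimedeanLocalField

namespace Summit.HodgeConjecture.HodgeConjecture.Cruxes.H413.K2E3CharLocIntSplitTwoNonSupercuspidal

/-! ## §1 The model side: `GL₂(F)` -/

section Model

variable (F : Type) [Field F] [ValuativeRel F] [TopologicalSpace F] [IsNonarchimedeanLocalField F] [CharZero F]
  [MeasurableSpace (GL (Fin 2) F)] [BorelSpace (GL (Fin 2) F)] (μ₀ : Measure (GL (Fin 2) F)) [μ₀.IsHaarMeasure]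

set_option maxHeartbeats 800000 in
/-- The (GL-11) conclusion at `g` for a class of `GL₂(F)` in the PRINCIPAL BLOCK: (2-S-A′) `principalBlockStandardSpan_two` writes `χ_{[r₀]}` as a ℤ-combination of
induced-from-characters traces and one-dimensional traces; each term is an integrable function near `g` (★ (nsc-vD-gen) over ★ (AC-B)₂; ★ (nsc-LC) for
characters), and the property is closed under finite linear combinations (★ (nsc-LC)).  The `N = 2` twin of U12's helper `charLocIntNear_of_principalBlock`.
[cite: Zelevinsky1980, Ex. 3.2] [cite: vanDijk1972, Thm. p. 237] [cite: HarishChandra1999, Thm. 16.1 p. 77] -/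
theorem charLocIntNear_of_principalBlock_two (r₀ : SmoothIrrep (GL (Fin 2) F)) (hadm : r₀.ρ.IsAdmissible)
    (c : Fin 2 → Fin 2) (hcm : Monotone c) (hcs : Function.Surjective c) (hnt : Nontrivial (Representation.restrictUnipotentGL F c r₀.ρ).Coinvariants)
    (g : GL (Fin 2) F) :
    ∃ U : Set (GL (Fin 2) F), IsOpen U ∧ g ∈ U ∧ ∃ Θ : GL (Fin 2) F → ℂ, IntegrableOn Θ U μ₀ ∧
      ∀ f : GL (Fin 2) F → ℂ, f ∈ SchwartzBruhat (GL (Fin 2) F) → tsupport f ⊆ U →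
        (IrrClass.mk r₀).smoothTrace μ₀ f = ∫ x, f x * Θ x ∂μ₀ := by
  obtain ⟨n₁, n₃, a, χ, e, η, hχ, hη, hspan⟩ := K2E3GL2PrincipalBlockStandardSpan.principalBlockStandardSpan_two F r₀ hadm c hcm hcs hnt
  have hB : Monotone (id : Fin 2 → Fin 2) := monotone_id
  refine K2E3CharLocIntNearLinearCombination.charLocIntNear_congr μ₀ _ _ g (fun f hf => hspan μ₀ f hf) ?_
  refine K2E3CharLocIntNearLinearCombination.charLocIntNear_add μ₀ _ _ g ?_ ?_
  · exact K2E3CharLocIntNearLinearCombination.charLocIntNear_finset_sum μ₀ Finset.univ (fun i => (a i : ℂ)) _ g fun i _ =>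
      K2E3CharLocIntNearParabolicIndOfAC.charLocIntNear_parabolicIndGL_of_ac hB (χ i) (hχ i) μ₀
        (fun νM _ μU _ μK _ A hA hA0 => K2E3GL2BorelKMUAbsCont.borelKMU_absolutelyContinuous_two F μ₀ νM μU μK A hA hA0) g
  · exact K2E3CharLocIntNearLinearCombination.charLocIntNear_finset_sum μ₀ Finset.univ (fun k => (e k : ℂ)) _ g fun k _ =>
      K2E3CharLocIntNearLinearCombination.charLocIntNear_trivial_twist_gl μ₀ (η k) (hη k) g

/-- **(GL-11) FOR EVERY NON-SUPERCUSPIDAL ADMISSIBLE IRREDUCIBLE OF `GL₂(F)`** (char `F = 0`), at every `g`: by Harish-Chandra's criterion (★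
`isSupercuspidal_iff_jacquetGL_holds`) a non-supercuspidal `π` has a non-zero Jacquet module along some proper standard parabolic `P_c`, `c : Fin 2 → Fin r`
surjective with `2 ≤ r ≤ 2`: the Borel, i.e. the principal block (§1 + ★ bricks); there is no two-block cuspidal-support case at `N = 2`.
[cite: BernsteinZelevinsky1977, Thm. 2.5] [cite: HarishChandra1999, Thm. 16.1 p. 77] -/
theorem charLocIntNear_gl2_of_not_isSupercuspidal (r₀ : SmoothIrrep (GL (Fin 2) F)) (hadm : r₀.ρ.IsAdmissible) (hsc : ¬ r₀.ρ.IsSupercuspidal) (g : GL (Fin 2) F) :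
    ∃ U : Set (GL (Fin 2) F), IsOpen U ∧ g ∈ U ∧ ∃ Θ : GL (Fin 2) F → ℂ, IntegrableOn Θ U μ₀ ∧
      ∀ f : GL (Fin 2) F → ℂ, f ∈ SchwartzBruhat (GL (Fin 2) F) → tsupport f ⊆ U →
        (IrrClass.mk r₀).smoothTrace μ₀ f = ∫ x, f x * Θ x ∂μ₀ := by
  haveI : r₀.ρ.IsIrreducible := r₀.isIrreducible
  have hiff := isSupercuspidal_iff_jacquetGL_holds F r₀.ρ r₀.isSmooth
  have hex : ∃ (r : ℕ) (c : Fin 2 → Fin r), IsProperBlocks c ∧ Monotone c ∧ ¬ Subsingleton (Representation.restrictUnipotentGL F c r₀.ρ).Coinvariants := by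
    by_contra h
    push Not at h
    exact hsc (hiff.2 fun r c hc hcm => h r c hc hcm)
  obtain ⟨r, c, hcP, hcm, hns⟩ := hex
  have hnt : Nontrivial (Representation.restrictUnipotentGL F c r₀.ρ).Coinvariants := not_subsingleton_iff_nontrivial.1 hns
  have hcs : Function.Surjective c := ((isProperBlocks_iff_two_le c).1 hcP).1
  have hr2 : 2 ≤ r := ((isProperBlocks_iff_two_le c).1 hcP).2
  have hr2' : r ≤ 2 := by simpa using Fintype.card_le_of_surjective c hcs
  obtain rfl : r = 2 := le_antisymm hr2' hr2
  exact charLocIntNear_of_principalBlock_two F μ₀ r₀ hadm c hcm hcs hnt g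

end Model

/-! ## §2 The leaf (11-2-split-nsc): transport to `U₂(H)(L⁺_v)` at a split place -/

open MeasureTheory.Measure in
/-- **LEAF (11-2-split-nsc) — ROW 11 FOR `U₂(H)(L⁺_v) ≃ GL₂(L_w)` AT A SPLIT PLACE `v`, NON-SUPERCUSPIDAL CLASS `c`** (the bytes of the U12 MAIN socket
`sig_K2E3CharLocIntNearSemisimpleSplitTwoNonSupercuspidal`, token for token): ★ (nsc-T) `charLocIntNearSemisimple_of_split_nonSupercuspidal` at `N = 2`
(`U₂(H)(L⁺_v) ≃ₜ* GL₂(L_w)` for `w ∣ v` moved by complex conjugation; admissibility of every class at a split place, `comap`-invariance of supercuspidality)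
fed with §1 `charLocIntNear_gl2_of_not_isSupercuspidal` on `GL₂(L_w)` (`L_w` has characteristic `0`).
[cite: vanDijk1972, Thm. p. 237] [cite: BernsteinZelevinsky1977, Thm. 2.5] [cite: HarishChandra1999, Thm. 16.1 p. 77] [cite: PlatonovRapinchuk1994, §5.1] -/
theorem charLocIntNearSemisimple_splitTwo_nonSupercuspidal :
  ∀ (L : Type) [Field L] [NumberField L] [IsCMField L] (H : Matrix (Fin 2) (Fin 2) L),
    (H.map (cmConjRingHom L))ᵀ = H → H.det ≠ 0 →
    ∀ (v : HeightOneSpectrum (𝓞 ↥(maximalRealSubfield L))), ¬ (∀ w : PlacesOver L v, IsCMField.complexConj L • w.1 = w.1) →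
    ∀ [MeasurableSpace ((UnitaryGroup.cmDatum L 2 H).Local v)] [BorelSpace ((UnitaryGroup.cmDatum L 2 H).Local v)]
      (μ : Measure ((UnitaryGroup.cmDatum L 2 H).Local v)) [μ.IsHaarMeasure]
      (c : IrrClass ((UnitaryGroup.cmDatum L 2 H).Local v)), ¬ c.IsSupercuspidal →
      ∀ s : (UnitaryGroup.cmDatum L 2 H).Local v, Module.End.IsSemisimple (Matrix.toLin' ((s.val : GL (Fin 2) (UnitaryGroup.LocalRing L v)).val : Matrix (Fin 2) (Fin 2) (UnitaryGroup.LocalRing L v))) →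
        ∃ U : Set ((UnitaryGroup.cmDatum L 2 H).Local v), IsOpen U ∧ s ∈ U ∧
          ∃ Θ : (UnitaryGroup.cmDatum L 2 H).Local v → ℂ, IntegrableOn Θ U μ ∧
            ∀ f : (UnitaryGroup.cmDatum L 2 H).Local v → ℂ, f ∈ SchwartzBruhat ((UnitaryGroup.cmDatum L 2 H).Local v) → tsupport f ⊆ U →
              c.smoothTrace μ f = ∫ g, f g * Θ g ∂μ := by
  intro L _ _ _ H hH hdet v hsplit _ _ μ _ c hsc s hss
  have hsplit' : ∃ w : UnitaryGroup.PlacesOver L v, IsCMField.complexConj L • w.1 ≠ w.1 := by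
    by_contra h
    push Not at h
    exact hsplit h
  obtain ⟨w, hw⟩ := hsplit'
  refine K2E3CharLocIntNearSplitNonSupercuspidalTransport.charLocIntNearSemisimple_of_split_nonSupercuspidal L 2 H v hH hdet w hw ?_ μ c hsc s hss
  intro _ _ μ₀ _ r₀ hadm₀ hsc₀ g _
  haveI : CharZero (w.1.adicCompletion L) := charZero_of_injective_algebraMap (algebraMap L (w.1.adicCompletion L)).injective
  exact charLocIntNear_gl2_of_not_isSupercuspidal (w.1.adicCompletion L) μ₀ r₀ hadm₀ hsc₀ g

end Summit.HodgeConjecture.HodgeConjecture.Cruxes.H413.K2E3CharLocIntSplitTwoNonSupercuspidal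

end
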